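import Mathlib
import Summits.MatrixMultiplication.MatrixMultiplication.Theorems.AutomaticSTPPDesignsAutomaticDesignBelowFourFifths
import Literature.Computability.AlgebraicComplexity.BigCwOmegaBound
import Literature.Computability.AlgebraicComplexity.GroupTheoreticMatMulThmBProofs
import Literature.Computability.AlgebraicComplexity.PrattTrapezoidVal
import Literature.Computability.AlgebraicComplexity.PrattTrapezoidValSTPP
import Summits.MatrixMultiplication.MatrixMultiplication.Theorems.AutomaticSTPPDesignsAutomaticPackingThesisPrattVal

/-!
# `Val(ℤ/nℤ) ≥ K · n^{7/6}`: the Coppersmith–Winograd design in one cyclic group, read for mass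

Support file for route `MatrixMultiplication/AutomaticSTPPDesigns`, crux
`stmt-MatrixMultiplication-7356` (`AutomaticPackingThesis`), and for the gate `gate-prattval`
(growth exponent `θ = limsup log Val(ℤ/nℤ)/log n` of Pratt's trapezoid-free count, arXiv:2309.03878
Def. 3.2; `θ < 4/3` would refute CKSU's two-families Conjecture 4.7 by Pratt's Thm. 4.7; STPP
designs certify lower bounds for `θ` through Prop. 3.3, never beyond `4/3` —
`STPPMassCap.sum_card_mul_le_rpow`).  The tree holds (crux `AutomaticDesignBelowFourFifths`, PROVED,
line `digit-sum-sliced-laser`) the Coppersmith–Winograd level-1 laser design for `CW_q` hosted in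
ONE cyclic group `ℤ/ℓ^{3a+3b}`, `ℓ = q+2` (`stub_typedFreeDiagonal`, `exists_slice`,
`stub_digitwise` = Kummer, `stub_slicedSTPP`: `|Δ|` blocks of size `|Sl|³`), read there at the
PACKING exponent `4/5`.  Here it is read for MASS `m = |Δ|·|Sl|³` against `M = ℓ^{3a+3b}`; the best
distribution has `b = 0` and limiting exponent `(H(1/3,2/3) + log q)/log(q+2)` (`1.1678, 1.1795,
1.1831` at `q = 6, 8, 11`).

* `massCount` — numerics at `q = 8`, `ℓ = 10`, `b = 0`, `a ≥ 10^6`: `7 log M ≤ 6 log m` (tree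
  `log_laserDiagonal_lower`, slice bound `8^a ≤ (7a+1)|Sl|`, one-sided constants for `log 2, 3, 5`;
  margin `0.19a` nats);
* `prattVal_ge_rpow_of_logBound` — digit design of mass `m > N` in `ℤ/N` with `r log N ≤ log m`
  ⇒ `Val(ℤ/nℤ) ≥ K n^r` (lossless digit-box powers, Pratt Prop. 3.3/4.3);
* `exists_digits_of_family`, `exists_cwDesign` — the design as an STPP digit design in a cyclic
  `ℤ/M`, `2 ≤ M < m`, `M^7 ≤ m^6`;
* `prattVal_ge_rpow_sevenSixths` — **`Val(ℤ/nℤ) ≥ K · n^{7/6}` for all `n ≥ 1`** (previous tree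
  record `log 9792/log 5814 = 1.0601`, `PrattValExponent.prattVal_ge_rpow`).

Remark (not formalised): the sliced encoding reads the STPP relation as a digitwise `x + y = z`
whose pattern `(1,1,0)` is `i + (q+1-i) = q+1` on the third leg, so base `q+2` is forced even at
`b = 0`; a carry-free base-`(q+1)` hosting of the simple CW tensor (limit `1.257` at `q = 4`) would
need a different encoding.

## References

* D. Coppersmith, S. Winograd, *Matrix multiplication via arithmetic progressions*, J. Symbolic
  Comput. 9 (1990), §7; P. Bürgisser, M. Clausen, M. A. Shokrollahi, *Algebraic Complexity Theory*
  (1997), Thm. 15.41.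
* H. Cohn, R. Kleinberg, B. Szegedy, C. Umans, FOCS 2005, arXiv:math/0511460, Def. 5.1, Lemma 5.4.
* K. Pratt, ITCS 2024, arXiv:2309.03878, Def. 3.2, Prop. 3.3, Prop. 4.3, Thm. 4.7.
-/

-- single-conjunct summit: the mandated namespace repeats `MatrixMultiplication`.
set_option linter.dupNamespace false

noncomputable section

namespace Summit.MatrixMultiplication.MatrixMultiplication.Theorems

namespace PrattValCW

open Finset Real Literature.Combinatorics.Additive Literature.Computability.AlgebraicComplexity
  Literature.Computability.AutomaticStructures AutomaticPackingThesis

/-! ### The mass count at `q = 8`, `b = 0` -/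

/-- The entropy term of `log_laserDiagonal_lower` at `b = 0` (types `(a, 2a, 0)`, `N = 3a`):
`N · H(1/3, 2/3, 0) = a · (3 log 3 − 2 log 2)`. [cite: CoppersmithWinograd1990, §7] -/
theorem massCount_entropy {a : ℕ} (ha : 0 < a) :
    ((3 * a + 3 * 0 : ℕ) : ℝ) *
        (∑ i, negMulLog (((![a + 2 * 0, 2 * a, 0] : Fin 3 → ℕ) i : ℝ) /
          ((3 * a + 3 * 0 : ℕ) : ℝ))) =
      (a : ℝ) * (3 * Real.log 3 - 2 * Real.log 2) := by
  have hx0 : (0 : ℝ) < (a : ℝ) := by exact_mod_cast ha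
  have hN : ((3 * a + 3 * 0 : ℕ) : ℝ) = 3 * (a : ℝ) := by push_cast; ring
  rw [Fin.sum_univ_three]
  simp only [Matrix.cons_val_zero, Matrix.cons_val_one, Matrix.cons_val_two, Matrix.head_cons,
    Matrix.tail_cons]
  rw [hN]
  have r0 : ((a + 2 * 0 : ℕ) : ℝ) / (3 * (a : ℝ)) = 1 / 3 := by
    rw [div_eq_div_iff (by positivity) (by norm_num)]; push_cast; ring
  have r1 : ((2 * a : ℕ) : ℝ) / (3 * (a : ℝ)) = 2 / 3 := by
    rw [div_eq_div_iff (by positivity) (by norm_num)]; push_cast; ring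
  have r2 : ((0 : ℕ) : ℝ) / (3 * (a : ℝ)) = 0 := by simp
  rw [r0, r1, r2, negMulLog_zero]
  have e0 : negMulLog ((1 : ℝ) / 3) = -(1 / 3) * (-Real.log 3) := by
    rw [negMulLog, Real.log_div (by norm_num) (by norm_num), Real.log_one]; ring
  have e1 : negMulLog ((2 : ℝ) / 3) = -(2 / 3) * (Real.log 2 - Real.log 3) := by
    rw [negMulLog, Real.log_div (by norm_num) (by norm_num)]
  rw [e0, e1]
  ring

/-- `120 √(3x) ≤ 0.2 x + 54000` for `x ≥ 0` (AM–GM at `√(3x) = 900`). [folklore] -/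
theorem massCount_sqrt_le (x : ℝ) (hx : 0 ≤ x) : 120 * √(3 * x) ≤ 0.2 * x + 54000 := by
  have h1 : 0 ≤ √(3 * x) := Real.sqrt_nonneg _
  have h2 : √(3 * x) ^ 2 = 3 * x := Real.sq_sqrt (by positivity)
  nlinarith [sq_nonneg (√(3 * x) - 900)]

/-- `18 log(7x + 1) ≤ 0.14 x + 16201` for `x ≥ 0` (`log y ≤ 2√y` and AM–GM at `√y = 900`).
[folklore] -/
theorem massCount_log_le (x : ℝ) (hx : 0 ≤ x) : 18 * Real.log (7 * x + 1) ≤ 0.14 * x + 16201 := by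
  have h0 : (0 : ℝ) < 7 * x + 1 := by positivity
  have h1 := log_le_two_mul_sqrt h0
  have h2 : 0 ≤ √(7 * x + 1) := Real.sqrt_nonneg _
  have h3 : √(7 * x + 1) ^ 2 = 7 * x + 1 := Real.sq_sqrt h0.le
  nlinarith [sq_nonneg (√(7 * x + 1) - 900)]

/-- **Mass count** (Coppersmith–Winograd 1990 §7 level-1 design for `CW_8`, read for MASS instead
of the packing exponent): with `b = 0` (no `x_{q+1}` coordinates), `a ≥ 10^6`, the size clause of the
free diagonal (`log p ≥ a(3 log 3 − 2 log 2) − 20√(3a) − log 96`, tree `log_laserDiagonal_lower`)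
and the slice bound `8^a ≤ (7a+1) S` give `(10^{3a})^7 ≤ (p S³)^6` in logarithms, i.e. the mass
`p S³` of the design has exponent at least `7/6` relative to the host order `10^{3a}`: per unit of
`a`, `18 log 3 + 21 log 2 − 21 log 5 ≥ 0.5307 > 0.34 + 10^{-6}·70772` (losses `120√(3a)`,
`18 log(7a+1)`, `6 log 96`). [cite: CoppersmithWinograd1990, §7] -/
theorem massCount :
    ∀ (a p S : ℕ), 1000000 ≤ a →
      Nat.multinomial univ ![a + 2 * 0, 2 * a, 0] *
          rothNumberNat (3 * ((2 * a).choose a * ((a + 2 * 0).choose a * (2 * 0).choose 0))) ≤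
        288 * ((2 * a).choose a * ((a + 2 * 0).choose a * (2 * 0).choose 0)) * p →
      8 ^ a ≤ (7 * a + 1) * S →
      0 < p ∧ 0 < S ∧
        7 * Real.log (((10 ^ (3 * a) : ℕ) : ℝ)) ≤ 6 * Real.log (((p * (S * S * S) : ℕ) : ℝ)) := by
  intro a p S ha hsize hS
  have hx : (1000000 : ℝ) ≤ (a : ℝ) := by exact_mod_cast ha
  have hx0 : (0 : ℝ) < (a : ℝ) := by linarith
  -- (1) the diagonal is large
  obtain ⟨hp0, hlogp⟩ := log_laserDiagonal_lower (p := p) (b := 0) (by omega : 1 ≤ a) hsize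
  rw [massCount_entropy (by omega : 0 < a)] at hlogp
  have hN : ((3 * a + 3 * 0 : ℕ) : ℝ) = 3 * (a : ℝ) := by push_cast; ring
  rw [hN] at hlogp
  have hp1 : 0 < p := by exact_mod_cast hp0
  -- (2) the slice is large: `a · 3 log 2 ≤ log(7a+1) + log S`
  have hS1 : 0 < S := by
    rcases Nat.eq_zero_or_pos S with h | h
    · rw [h, mul_zero] at hS
      exact absurd hS (not_le.2 (by positivity))
    · exact h
  have hSr : (0 : ℝ) < (S : ℝ) := by exact_mod_cast hS1
  have hS' : (8 : ℝ) ^ a ≤ ((7 * a + 1 : ℕ) : ℝ) * (S : ℝ) := by exact_mod_cast hS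
  have hlogS : (a : ℝ) * (3 * Real.log 2) ≤ Real.log (7 * (a : ℝ) + 1) + Real.log S := by
    have h := Real.log_le_log (by positivity) hS'
    rw [Real.log_pow, Real.log_mul (by positivity) hSr.ne'] at h
    have h7a : ((7 * a + 1 : ℕ) : ℝ) = 7 * (a : ℝ) + 1 := by push_cast; ring
    have e8 : Real.log 8 = 3 * Real.log 2 := by
      rw [show (8 : ℝ) = 2 ^ 3 by norm_num, Real.log_pow]; push_cast; ring
    rw [h7a, e8] at h
    linarith
  refine ⟨hp1, hS1, ?_⟩
  -- (3) logarithmic form of the goal: `21a (log 2 + log 5) ≤ 6 log p + 18 log S`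
  have e10 : Real.log (((10 ^ (3 * a) : ℕ) : ℝ)) = 3 * (a : ℝ) * (Real.log 2 + Real.log 5) := by
    rw [Nat.cast_pow, Real.log_pow, show ((10 : ℕ) : ℝ) = 2 * 5 by norm_num,
      Real.log_mul (by norm_num) (by norm_num)]
    push_cast; ring
  have emass : Real.log (((p * (S * S * S) : ℕ) : ℝ)) = Real.log p + 3 * Real.log S := by
    push_cast
    rw [Real.log_mul hp0.ne' (mul_pos (mul_pos hSr hSr) hSr).ne',
      Real.log_mul (mul_pos hSr hSr).ne' hSr.ne', Real.log_mul hSr.ne' hSr.ne']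
    ring
  rw [e10, emass]
  -- (4) numerics with one-sided constants
  have hL2 := Real.log_two_lt_d9
  have hL2' := Real.log_two_gt_d9
  have hL3 := log_three_gt
  have hL5 := log_five_lt
  have p2 : (a : ℝ) * Real.log 2 ≤ (a : ℝ) * 0.6931471808 := mul_le_mul_of_nonneg_left hL2.le hx0.le
  have p2' : (a : ℝ) * 0.6931471803 ≤ (a : ℝ) * Real.log 2 :=
    mul_le_mul_of_nonneg_left hL2'.le hx0.le
  have p3 : (a : ℝ) * 1.09852 ≤ (a : ℝ) * Real.log 3 := mul_le_mul_of_nonneg_left hL3.le hx0.le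
  have p5 : (a : ℝ) * Real.log 5 ≤ (a : ℝ) * 1.60946 := mul_le_mul_of_nonneg_left hL5.le hx0.le
  have hsb := massCount_sqrt_le (a : ℝ) hx0.le
  have hlb := massCount_log_le (a : ℝ) hx0.le
  have h96 : Real.log 96 ≤ 96 - 1 := Real.log_le_sub_one_of_pos (by norm_num)
  nlinarith [p2, p2', p3, p5, hsb, hlb, h96, hlogp, hlogS]

/-! ### From a digit design with a logarithmic mass bound to a rational growth exponent -/

/-- **Rational growth exponent from a digit design.** An STPP digit design of mass `m > N` in
`ℤ/N` (`N ≥ 2`) with `r · log N ≤ log m` gives `Val(ℤ/nℤ) ≥ K · n^r` for all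
`n ≥ 1` (`K = (6N)^{-σ}`, `σ = log m/log N ≥ r`): digit boxes at scale `k` have mass `m^k` in
`ℤ/N^k` (`addSimultaneousTPP_digitBox`, `sum_card_digitBox`) and move to every modulus
`n ≥ 3N^k` (`sum_card_le_prattVal_of_three_mul_le`, Pratt Prop. 3.3 / 4.3); for `n ≥ 3N` take
`N^k ≤ n/3 < N^{k+1}`, for `n < 3N` use `Val ≥ n`; finally `n^r ≤ n^σ`.  (The `σ`-form is
`PrattValLocalUSP.prattVal_ge_rpow_of_digitDesign` of `…PrattValLocalUSP.lean`.)
[cite: Pratt2024, Prop. 3.3 and Prop. 4.3] -/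
theorem prattVal_ge_rpow_of_logBound {N s m : ℕ} (hN : 2 ≤ N) (hNm : N < m)
    (DA DB DC : Fin s → Finset (Fin N))
    (hD : AddSimultaneousTPP
      (fun i => (DA i).image fun d : Fin N => ((d : ℕ) : ZMod N))
      (fun i => (DB i).image fun d : Fin N => ((d : ℕ) : ZMod N))
      (fun i => (DC i).image fun d : Fin N => ((d : ℕ) : ZMod N)))
    (hm : ∑ i, #(DA i) * #(DB i) * #(DC i) = m) {r : ℝ}
    (hr : r * Real.log N ≤ Real.log m) :
    ∃ K : ℝ, 0 < K ∧ ∀ (n : ℕ) (_ : NeZero n),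
      K * (n : ℝ) ^ r ≤ (prattVal (ZMod n) : ℝ) := by
  classical
  haveI : NeZero N := ⟨by omega⟩
  have hNR : (1 : ℝ) < N := by exact_mod_cast (by omega : 1 < N)
  have hNpos : (0 : ℝ) < N := by linarith
  have hmR : (N : ℝ) < m := by exact_mod_cast hNm
  have hlogb : 0 < Real.log N := Real.log_pos hNR
  have hlogm : Real.log N < Real.log m := Real.log_lt_log hNpos hmR
  set σ : ℝ := Real.log m / Real.log N with hσ
  have h1σ : 1 < σ := by
    rw [hσ, lt_div_iff₀ hlogb, one_mul]
    exact hlogm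
  have hσpos : 0 < σ := by linarith
  have hrσ : r ≤ σ := by
    rw [hσ, le_div_iff₀ hlogb]
    exact hr
  -- digit boxes: `m^k ≤ Val(ℤ/M)` for `M ≥ 3 N^k`
  have hval : ∀ (k M : ℕ) [NeZero M], 3 * N ^ k ≤ M → m ^ k ≤ prattVal (ZMod M) := by
    intro k M _ hM
    haveI : NeZero (N ^ k) := ⟨pow_ne_zero _ (NeZero.ne N)⟩
    have h := sum_card_le_prattVal_of_three_mul_le (addSimultaneousTPP_digitBox DA DB DC hD k) hM
    rwa [sum_card_digitBox DA DB DC k, hm] at h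
  -- `N^σ = m`, hence `(N^k)^σ = m^k`
  have hpow : ∀ k : ℕ, (((N ^ k : ℕ) : ℕ) : ℝ) ^ σ = ((m ^ k : ℕ) : ℝ) := by
    intro k
    have hbm : (N : ℝ) ^ σ = m := by
      rw [Real.rpow_def_of_pos hNpos]
      have : Real.log N * σ = Real.log m := by
        rw [hσ]; field_simp
      rw [this, Real.exp_log (by linarith)]
    push_cast
    rw [← Real.rpow_natCast, ← Real.rpow_mul hNpos.le, mul_comm, Real.rpow_mul hNpos.le, hbm,
      Real.rpow_natCast]
  have h6N : (0 : ℝ) < 6 * N := by positivity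
  refine ⟨(1 / (6 * N) : ℝ) ^ σ, Real.rpow_pos_of_pos (by positivity) _, ?_⟩
  intro n hn
  have hn1 : 1 ≤ n := Nat.one_le_iff_ne_zero.2 (NeZero.ne n)
  have hnR : (1 : ℝ) ≤ n := by exact_mod_cast hn1
  -- `n^r ≤ n^σ`
  have hnr : (n : ℝ) ^ r ≤ (n : ℝ) ^ σ := Real.rpow_le_rpow_of_exponent_le hnR hrσ
  have hKpos : 0 < (1 / (6 * N) : ℝ) ^ σ := Real.rpow_pos_of_pos (by positivity) _
  refine le_trans (mul_le_mul_of_nonneg_left hnr hKpos.le) ?_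
  have hK : (1 / (6 * N) : ℝ) ^ σ * (n : ℝ) ^ σ = ((n : ℝ) / (6 * N)) ^ σ := by
    rw [← Real.mul_rpow (by positivity) (by positivity)]
    congr 1
    ring
  rw [hK]
  by_cases hsmall : n < 3 * N
  · -- small moduli: `Val ≥ |G| = n ≥ n/(6N) ≥ (n/(6N))^σ`
    have hle1 : (n : ℝ) / (6 * N) ≤ 1 := by
      rw [div_le_one h6N]
      exact_mod_cast (by omega : n ≤ 6 * N)
    have hpos : 0 < (n : ℝ) / (6 * N) := by positivity
    calc ((n : ℝ) / (6 * N)) ^ σ ≤ ((n : ℝ) / (6 * N)) ^ (1 : ℝ) :=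
          Real.rpow_le_rpow_of_exponent_ge hpos hle1 h1σ.le
      _ = (n : ℝ) / (6 * N) := Real.rpow_one _
      _ ≤ n := by
          rw [div_le_iff₀ h6N]
          nlinarith
      _ = (Fintype.card (ZMod n) : ℝ) := by rw [ZMod.card]
      _ ≤ (prattVal (ZMod n) : ℝ) := by exact_mod_cast card_le_prattVal
  · -- large moduli: `N^k ≤ n/3 < N^(k+1)`
    push Not at hsmall
    set k : ℕ := Nat.log N (n / 3) with hk
    have hn3 : n / 3 ≠ 0 := by omega
    have hlow : N ^ k ≤ n / 3 := Nat.pow_log_le_self N hn3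
    have hup : n / 3 < N ^ (k + 1) := Nat.lt_pow_succ_log_self (by omega) _
    have h3 : 3 * N ^ k ≤ n := by omega
    have hvaln := hval k n h3
    have hnb : (n : ℝ) / (6 * N) ≤ (((N ^ k : ℕ) : ℕ) : ℝ) := by
      rw [div_le_iff₀ h6N]
      have : n ≤ N ^ k * (6 * N) := by
        have h' : n < 3 * N ^ (k + 1) + 3 := by omega
        rw [pow_succ] at h'
        have hNk : 1 ≤ N ^ k * N := Nat.one_le_iff_ne_zero.2 (by positivity)
        nlinarith
      exact_mod_cast this
    calc ((n : ℝ) / (6 * N)) ^ σ ≤ (((N ^ k : ℕ) : ℕ) : ℝ) ^ σ :=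
          Real.rpow_le_rpow (by positivity) hnb hσpos.le
      _ = ((m ^ k : ℕ) : ℝ) := hpow k
      _ ≤ (prattVal (ZMod n) : ℝ) := by exact_mod_cast hvaln

/-! ### Digit form of a family in `ℤ/M` -/

/-- **Every family of subsets of `ℤ/M` is a digit family**: reading residues as digits `Fin M`
(`x ↦ x.val`) and back is the identity, so an STPP family in `ℤ/M` is an STPP digit design with the
same block sizes. [folklore] -/
theorem exists_digits_of_family {M s : ℕ} [NeZero M] (A B C : Fin s → Finset (ZMod M))
    (hS : AddSimultaneousTPP A B C) :
    ∃ DA DB DC : Fin s → Finset (Fin M),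
      AddSimultaneousTPP
        (fun i => (DA i).image fun d : Fin M => ((d : ℕ) : ZMod M))
        (fun i => (DB i).image fun d : Fin M => ((d : ℕ) : ZMod M))
        (fun i => (DC i).image fun d : Fin M => ((d : ℕ) : ZMod M)) ∧
      ∀ i, #(DA i) * #(DB i) * #(DC i) = #(A i) * #(B i) * #(C i) := by
  classical
  obtain ⟨ψ, hψ⟩ : ∃ ψ : ZMod M → Fin M, ∀ x, (((ψ x : Fin M) : ℕ) : ZMod M) = x :=
    ⟨fun x => ⟨x.val, ZMod.val_lt _⟩, fun x => ZMod.natCast_zmod_val x⟩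
  have hψinj : Function.Injective ψ := fun x y h => by rw [← hψ x, ← hψ y, h]
  have himg : ∀ T : Finset (ZMod M),
      (T.image ψ).image (fun d : Fin M => ((d : ℕ) : ZMod M)) = T := by
    intro T
    rw [Finset.image_image]
    conv_rhs => rw [← Finset.image_id (s := T)]
    exact Finset.image_congr fun x _ => hψ x
  refine ⟨fun i => (A i).image ψ, fun i => (B i).image ψ, fun i => (C i).image ψ, ?_, ?_⟩
  · simp only [himg]
    exact hS
  · intro i
    simp only [card_image_of_injective _ hψinj]

/-! ### The Coppersmith–Winograd design in `ℤ/10^{3a}`, read for mass -/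

/-- **A cyclic STPP digit design of mass exponent `≥ 7/6`.** The tree's digit-sum-sliced
Coppersmith–Winograd design (line `digit-sum-sliced-laser` of crux `AutomaticDesignBelowFourFifths`:
`stub_typedFreeDiagonal`, `exists_slice`, `stub_slicedSTPP`, `stub_digitwise`), instantiated at
`q = 8`, base `ℓ = 10`, `b = 0`, `a = 10^6`: an STPP family in the cyclic group `ℤ/M`,
`M = 10^{3a}`, of mass `m = |Δ|·S³` with `M^7 ≤ m^6` (in logarithms, `massCount`), in digit form.
[cite: CoppersmithWinograd1990, §7] [cite: CohnKleinbergSzegedyUmans2005, Def. 5.1] -/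
theorem exists_cwDesign : ∃ (M s m : ℕ) (DA DB DC : Fin s → Finset (Fin M)),
    2 ≤ M ∧ M < m ∧
    AddSimultaneousTPP
      (fun i => (DA i).image fun d : Fin M => ((d : ℕ) : ZMod M))
      (fun i => (DB i).image fun d : Fin M => ((d : ℕ) : ZMod M))
      (fun i => (DC i).image fun d : Fin M => ((d : ℕ) : ZMod M)) ∧
    ∑ i, #(DA i) * #(DB i) * #(DC i) = m ∧
    7 * Real.log M ≤ 6 * Real.log m := by
  classical
  obtain ⟨a, ha⟩ : ∃ a : ℕ, 1000000 ≤ a := ⟨1000000, le_rfl⟩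
  -- the typed free diagonal with no `x_{q+1}` coordinates (`b = 0`)
  obtain ⟨Δ, hwt, hpat, htyp, hfree, hsize⟩ :=
    AutomaticDesignBelowFourFifths.stub_typedFreeDiagonal a 0
  -- a large slice of `[0,8)^a` of constant digit sum
  obtain ⟨Sl, σ, hSl, hslice⟩ := AutomaticDesignBelowFourFifths.exists_slice 8 a
  have hslice' : 8 ^ a ≤ (7 * a + 1) * Sl.card := by
    simpa only [show (8 - 1 : ℕ) = 7 by norm_num] using hslice
  -- the sliced family is STPP in `ℤ/10^(3a)` (Kummer digitwise at base 10)
  obtain ⟨A, B, C, hS, hcard⟩ :=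
    AutomaticDesignBelowFourFifths.stub_slicedSTPP 8 10 (3 * a + 3 * 0) a 0 (by norm_num) rfl
      (AutomaticDesignBelowFourFifths.stub_digitwise 10 (3 * a + 3 * 0) (by norm_num)) Δ hwt hpat
      htyp hfree Sl σ hSl
  -- the mass count
  obtain ⟨hp, hSpos, hlog⟩ := massCount a Δ.card Sl.card ha hsize hslice'
  haveI : NeZero (10 ^ (3 * a + 3 * 0)) := ⟨pow_ne_zero _ (by norm_num)⟩
  have hS' := (isSTPP_iff_addSimultaneousTPP A B C).1 hS
  obtain ⟨DA, DB, DC, hD, hvol⟩ := exists_digits_of_family A B C hS'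
  have hM : (10 : ℕ) ^ (3 * a + 3 * 0) = 10 ^ (3 * a) := by rw [Nat.mul_zero, Nat.add_zero]
  have hmass : ∑ i, #(DA i) * #(DB i) * #(DC i) = Δ.card * (Sl.card * Sl.card * Sl.card) := by
    have hrow : ∀ i, #(DA i) * #(DB i) * #(DC i) = Sl.card * Sl.card * Sl.card := fun i => by
      rw [hvol i]
      obtain ⟨h1, h2, h3⟩ := hcard i
      rw [h1, h2, h3]
    simp only [hrow, sum_const, card_univ, Fintype.card_fin, smul_eq_mul]
  have hMR : (1 : ℝ) < (((10 : ℕ) ^ (3 * a + 3 * 0) : ℕ) : ℝ) := by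
    rw [hM]
    have : 1 < (10 : ℕ) ^ (3 * a) := Nat.one_lt_pow (by omega) (by norm_num)
    exact_mod_cast this
  have hlogM : 0 < Real.log (((10 : ℕ) ^ (3 * a + 3 * 0) : ℕ) : ℝ) := Real.log_pos hMR
  have hlog' : 7 * Real.log ((((10 : ℕ) ^ (3 * a + 3 * 0) : ℕ) : ℝ)) ≤
      6 * Real.log (((Δ.card * (Sl.card * Sl.card * Sl.card) : ℕ) : ℝ)) := by
    rw [hM]; exact hlog
  have hmpos : (0 : ℝ) < ((Δ.card * (Sl.card * Sl.card * Sl.card) : ℕ) : ℝ) := by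
    have : 0 < Δ.card * (Sl.card * Sl.card * Sl.card) := by positivity
    exact_mod_cast this
  refine ⟨10 ^ (3 * a + 3 * 0), Δ.card, Δ.card * (Sl.card * Sl.card * Sl.card), DA, DB, DC,
    ?_, ?_, hD, hmass, hlog'⟩
  · have : 1 < (10 : ℕ) ^ (3 * a + 3 * 0) := by exact_mod_cast hMR
    omega
  · -- `M < m`: `6 log m ≥ 7 log M > 6 log M`
    have hlt : Real.log ((((10 : ℕ) ^ (3 * a + 3 * 0) : ℕ) : ℝ)) <
        Real.log (((Δ.card * (Sl.card * Sl.card * Sl.card) : ℕ) : ℝ)) := by linarith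
    rw [Real.log_lt_log_iff (by linarith) hmpos] at hlt
    exact_mod_cast hlt

/-! ### The exponent `7/6` -/

/-- **`Val(ℤ/nℤ) ≥ K · n^{7/6}` for all `n ≥ 1`.** The growth exponent
`θ = limsup log Val(ℤ/nℤ)/log n` of Pratt's trapezoid-free count satisfies `θ ≥ 7/6`: the
Coppersmith–Winograd laser design, hosted in ONE cyclic group by digit-sum slicing
(`AutomaticDesignBelowFourFifths`, tree) and read for mass at `q = 8`, `ℓ = 10`, `b = 0`
(`exists_cwDesign`: mass `m ≥ M^{7/6}`), powered losslessly along the `M`-tower and transferred to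
every modulus (`prattVal_ge_rpow_of_logBound`, Pratt Prop. 3.3 / 4.3).  The same
design family has limiting mass exponent `(log 8 + H(1/3,2/3))/log 10 = 1.1795…` (`1.1831…` at
`q = 11`); STPP designs can never certify more than `4/3` (`STPPMassCap.sum_card_mul_le_rpow`), the
threshold of Pratt's Thm. 4.7. [cite: Pratt2024, Prop. 3.3 and Prop. 4.3]
[cite: CoppersmithWinograd1990, §7] -/
theorem prattVal_ge_rpow_sevenSixths : ∃ K : ℝ, 0 < K ∧ ∀ (n : ℕ) (_ : NeZero n),
    K * (n : ℝ) ^ ((7 : ℝ) / 6) ≤ (prattVal (ZMod n) : ℝ) := by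
  obtain ⟨M, s, m, DA, DB, DC, hM2, hMm, hD, hm, hlog⟩ := exists_cwDesign
  exact prattVal_ge_rpow_of_logBound hM2 hMm DA DB DC hD hm (r := (7 : ℝ) / 6) (by linarith)

end PrattValCW

end Summit.MatrixMultiplication.MatrixMultiplication.Theorems

end
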